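import Summits.BirchSwinnertonDyer.Rank1Residual.X11b.RouteR1LogOmega
import Summits.BirchSwinnertonDyer.Rank1Residual.X1.UnrSeriesFirstUnitCoeff
import Literature.NumberTheory.EllipticCurves.HeegnerPointReflectionHolds
import HarnessLib

set_option autoImplicit false

/-!
# Algebra of `Λ_{R₀} = R₀⟦T⟧` behind the Yan–Zhu ∘ BCS ∘ CGLS composites (the μ-comparison), and the
# RANK-FREE symmetry `(log_{ω_E} τ_* P_K)² = (log_{ω_E} P_K)²` from Darmon 2004 Prop. 3.11 (discharged)

Cell `pub/bsd-print-x9` (D-0131 (2) PRINT tier), typer seat ty1 (gen 16). File 1 of 2 (file 2 =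
`X11b/YZCompositeOfFrames.lean`, which DERIVES the two composite named facts
`YanZhu2026.thm57_thm59_bcs422_cgls513_generator_constantCoeff_of_heegnerDivisibility` (p563407) and
`YanZhu2026.thm57_bcs422_cgls513_generator_constantCoeff` (p543659) from the four single-source frame facts).
THEOREMS ONLY (no definition, no named fact, no `sorry`); nothing about any curve is asserted; pure algebra
over the tree's receptacle `R₀⟦T⟧` (`UnrSeries p`; bsd-eis toolkit `X1.KellerYinHalves.*`: first unit
coefficient, `exists_mul_eq_of_mul_eq_C_pow_mul`, `exists_eq_C_mul_of_forall_norm_lt_one`) plus one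
reading of Darmon 2004 Prop. 3.11 (tree THEOREM `heegnerPoint_conj_add_rootNumber_smul_holds`).

* §1 `exists_eq_C_pow_mul_unit_of_C_pow_eq_mul` (`p^k = a·G` ⟹ `G = p^m·unit`),
  `exists_firstUnitCoeffAt_of_span_eq` (`μ = 0` passes along equal ideals),
  `span_eq_of_C_pow_mul_mem_of_mem` (TWO-SIDED μ-comparison: `p^k·F' ∈ (L)`, `L ∈ (F')`, `μ(L) = 0` ⟹
  `(F') = (L)` — p563407's docstring (i)–(iii) in the kernel), `exists_eq_C_pow_mul_unit_mul` (ONE-SIDED: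
  `p^k·L ∈ (F')`, `p^k'·F' ∈ (L)`, `μ(L) = 0` ⟹ `F' = p^m·unit·L` — p543659's docstring).
* §2 `sq_padicLogOmega_map_eq_of_isHeegnerPoint` — for a Heegner point `P ∈ E(K)` of level `N_E` and ANY
  `ℚ`-automorphism `τ` of `K`, `(log_{ω_E} τ_* P)² = (log_{ω_E} P)²` along any `ι : K → ℚ_p`, WITHOUT a rank
  hypothesis (`τ_* P + w(E)·P` is torsion; the route-R1 lemma `X11b.R1.sq_logOmega_map_eq_of_rank_one`
  needs `rank E(K) = 1`); `exists_algHom_map_map_eq` — the Galois re-reading of a Heegner datum through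
  THE infinite place (as `X1.KellerYinHalves.exists_involution_map_eq`, with `τ` an algebra automorphism).

References: [Washington1997] §7.1; [YanZhu2024MainConjNonCM] proof of Thm. 5.7 (arXiv:2412.20078v4
l.1294–1308); [Darmon2004] Prop. 3.11, §3.9; [SilvermanAEC2009] IV.6.4, VII.6.3.
-/

noncomputable section

open scoped Classical

open PowerSeries WeierstrassCurve NumberField IsDedekindDomain Field
  Literature.NumberTheory.EllipticCurves Literature.NumberTheory.EllipticCurves.ModularForms
  Literature.NumberTheory.EllipticCurves.Rank1Residual
  Literature.NumberTheory.EllipticCurves.Castella2018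
  Summit.BirchSwinnertonDyer.Rank1Residual
  Summit.BirchSwinnertonDyer.Rank1Residual.X11b.Halves
  Summit.BirchSwinnertonDyer.Rank1Residual.X1.KellerYinHalves
open Literature.NumberTheory.LFunctions.Dwork (norm_natCast_p_padicComplex)

namespace Summit.BirchSwinnertonDyer.Rank1Residual.X11b.YZComposite

/-! ### §1 Algebra in `Λ_{R₀} = R₀⟦T⟧` (the μ-comparison of p563407's docstring (i)–(iii), in the kernel) -/

section Algebra

variable {p : ℕ} [Fact p.Prime]

/-- `C(p) ≠ 0` in `R₀⟦T⟧`. [folklore] -/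
theorem C_natCast_ne_zero : (C (p : unrIntegers p) : UnrSeries p) ≠ 0 := by
  intro h0
  have := congrArg constantCoeff h0
  simp only [map_zero, constantCoeff_C] at this
  exact (Fact.out : p.Prime).ne_zero
    (by exact_mod_cast congrArg (fun x : unrIntegers p ↦ (x : ℂ_[p])) this)

/-- **`p`-power cofactors**: if `C(p^k) = a · G` in `R₀⟦T⟧` then `G = C(p^m) · U` for a unit `U`
(induction on `k`: either `G` has a unit coefficient — then `G ∣ p^k` forces `G` to be a unit,
`exists_mul_eq_of_mul_eq_C_pow_mul` — or `p ∣ G` coefficientwise). [cite: Washington1997, §7.1] -/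
theorem exists_eq_C_pow_mul_unit_of_C_pow_eq_mul :
    ∀ (k : ℕ) {a G : UnrSeries p}, C ((p : unrIntegers p) ^ k) = a * G →
      ∃ (m : ℕ) (U : (UnrSeries p)ˣ), G = C ((p : unrIntegers p) ^ m) * U := by
  intro k
  induction k with
  | zero =>
    intro a G h
    rw [pow_zero, map_one] at h
    have hG : IsUnit G := IsUnit.of_mul_eq_one_right a h.symm
    exact ⟨0, hG.unit, by rw [pow_zero, map_one, one_mul, IsUnit.unit_spec]⟩
  | succ k ih =>
    intro a G h
    by_cases hall : ∀ j, ‖((coeff j G : unrIntegers p) : ℂ_[p])‖ < 1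
    · -- `p ∣ G` coefficientwise: peel one factor `p` and recurse
      obtain ⟨G₁, rfl⟩ := exists_eq_C_mul_of_forall_norm_lt_one hall
      have h' : C ((p : unrIntegers p) ^ k) = a * G₁ := by
        apply mul_left_cancel₀ (C_natCast_ne_zero (p := p))
        calc C (p : unrIntegers p) * C ((p : unrIntegers p) ^ k)
            = C ((p : unrIntegers p) ^ (k + 1)) := by rw [pow_succ, map_mul, mul_comm]
          _ = a * (C (p : unrIntegers p) * G₁) := h
          _ = C (p : unrIntegers p) * (a * G₁) := by ring
      obtain ⟨m, U, hU⟩ := ih h'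
      refine ⟨m + 1, U, ?_⟩
      rw [hU, pow_succ, map_mul]
      ring
    · -- `G` has a unit coefficient, hence a first one; then `G ∣ p^(k+1)` makes `G` a unit
      push Not at hall
      obtain ⟨j, hj⟩ := hall
      obtain ⟨b, -, hb⟩ := exists_firstUnitCoeffAt_of_exists_le (G := G) ⟨j, le_rfl, not_lt.mpr hj⟩
      obtain ⟨G', hG'⟩ := exists_mul_eq_of_mul_eq_C_pow_mul (L := 1) hb
        (show G * a = C ((p : unrIntegers p) ^ (k + 1)) * 1 by rw [mul_one, h, mul_comm])
      have hG : IsUnit G := IsUnit.of_mul_eq_one G' hG'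
      exact ⟨0, hG.unit, by rw [pow_zero, map_one, one_mul, IsUnit.unit_spec]⟩

/-- **`μ = 0` passes along equal ideals.** If `(L₂) = (L)` in `R₀⟦T⟧` and SOME coefficient of `L₂` is a
unit of `R₀` (the typed form of `μ(L₂) = 0`, BCS Prop. 4.2.2), then `L` has a FIRST unit coefficient
(`L = L₂ · V` with `V` a unit; Gauss's lemma `firstUnitCoeffAt_mul`). [cite: Washington1997, §7.1] -/
theorem exists_firstUnitCoeffAt_of_span_eq {L L₂ : UnrSeries p}
    (h : Ideal.span ({L₂} : Set (UnrSeries p)) = Ideal.span {L}) (hμ : ∃ k, IsUnit (coeff k L₂)) :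
    ∃ n, ‖((coeff n L : unrIntegers p) : ℂ_[p])‖ = 1 ∧
      ∀ i < n, ‖((coeff i L : unrIntegers p) : ℂ_[p])‖ < 1 := by
  obtain ⟨k, hk⟩ := hμ
  obtain ⟨V, hV⟩ := Ideal.span_singleton_eq_span_singleton.mp h
  have hk1 : ‖((coeff k L₂ : unrIntegers p) : ℂ_[p])‖ = 1 :=
    (unrIntegers.isUnit_iff_norm_eq_one _).mp hk
  obtain ⟨b, -, hb⟩ := exists_firstUnitCoeffAt_of_exists_le (G := L₂)
    ⟨k, le_rfl, by rw [hk1]; exact lt_irrefl 1⟩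
  have hV0 : ‖((coeff 0 (V : UnrSeries p) : unrIntegers p) : ℂ_[p])‖ = 1 ∧
      ∀ i < 0, ‖((coeff i (V : UnrSeries p) : unrIntegers p) : ℂ_[p])‖ < 1 := by
    refine ⟨?_, fun i hi ↦ absurd hi (Nat.not_lt_zero i)⟩
    rw [coeff_zero_eq_constantCoeff_apply]
    exact (unrIntegers.isUnit_iff_norm_eq_one _).mp (isUnit_constantCoeff _ V.isUnit)
  have hL := firstUnitCoeffAt_mul hb hV0
  rw [hV, add_zero] at hL
  exact ⟨b, hL⟩

/-- A series with a unit coefficient is non-zero. [folklore] -/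
theorem ne_zero_of_firstUnitCoeffAt {L : UnrSeries p} {n : ℕ}
    (hL : ‖((coeff n L : unrIntegers p) : ℂ_[p])‖ = 1 ∧
      ∀ i < n, ‖((coeff i L : unrIntegers p) : ℂ_[p])‖ < 1) : L ≠ 0 := by
  intro h0
  have h1 := hL.1
  rw [h0, map_zero, ZeroMemClass.coe_zero, norm_zero] at h1
  exact zero_ne_one h1

/-- **The μ-comparison (two-sided).** In `R₀⟦T⟧`: if `C(p^k) · F' ∈ (L)` (Yan–Zhu Thm. 5.7 (1), the
rational `⊆`), `L ∈ (F')` (Thm. 5.9 fed with Howard's containment) and `L` has a first unit coefficient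
(`μ(L) = 0`, Prop. 4.2.2 along rigidity), then `(F') = (L)`: writing `L = h·F'`, `p^k = b·h`, and `h`
has a unit coefficient (else every coefficient of `L = h·F'` has norm `< 1`), so `h ∣ p^k` makes `h` a
unit. [cite: YanZhu2024MainConjNonCM, proof of Thm. 5.7 (arXiv:2412.20078v4 TeX l.1294–1308)]
[cite: Washington1997, §7.1] -/
theorem span_eq_of_C_pow_mul_mem_of_mem {F' L : UnrSeries p} {k n : ℕ}
    (h1 : C ((p : unrIntegers p) ^ k) * F' ∈ Ideal.span ({L} : Set (UnrSeries p)))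
    (h2 : L ∈ Ideal.span ({F'} : Set (UnrSeries p)))
    (hL : ‖((coeff n L : unrIntegers p) : ℂ_[p])‖ = 1 ∧
      ∀ i < n, ‖((coeff i L : unrIntegers p) : ℂ_[p])‖ < 1) :
    Ideal.span ({F'} : Set (UnrSeries p)) = Ideal.span {L} := by
  obtain ⟨b, hb⟩ := Ideal.mem_span_singleton'.mp h1
  obtain ⟨h, hh⟩ := Ideal.mem_span_singleton'.mp h2
  have hL0 : L ≠ 0 := ne_zero_of_firstUnitCoeffAt hL
  have hF0 : F' ≠ 0 := by
    intro h0; apply hL0; rw [← hh, h0, mul_zero]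
  -- `C(p^k) = b * h`
  have hbh : C ((p : unrIntegers p) ^ k) = b * h := by
    apply mul_right_cancel₀ hF0
    rw [mul_assoc, hh, hb]
  -- `h` has a unit coefficient
  have hex : ∃ j ≤ n, ¬ ‖((coeff j h : unrIntegers p) : ℂ_[p])‖ < 1 := by
    by_contra hc
    push Not at hc
    have hlt := norm_coeff_mul_lt_one_of_forall_lt (F := F') hc
    rw [mul_comm, hh] at hlt
    exact hlt.ne hL.1
  obtain ⟨a, -, ha⟩ := exists_firstUnitCoeffAt_of_exists_le hex
  obtain ⟨G', hG'⟩ := exists_mul_eq_of_mul_eq_C_pow_mul (L := 1) ha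
    (show h * b = C ((p : unrIntegers p) ^ k) * 1 by rw [mul_one, hbh, mul_comm])
  have hu : IsUnit h := IsUnit.of_mul_eq_one G' hG'
  rw [← hh, Ideal.span_singleton_mul_left_unit hu]

/-- **The μ-comparison (one-sided).** In `R₀⟦T⟧`: if `C(p^k) · L ∈ (F')` and `C(p^k') · F' ∈ (L)` (the two
rational halves of Yan–Zhu Thm. 5.7 (1)) and `L` has a first unit coefficient (`μ(L) = 0`), then
`F' = C(p^m) · U · L` for some `m` and a unit `U` (`μ(L) = 0` absorbs `p^k'`: `F' = L·G'`; then
`p^k = a·G'` and `exists_eq_C_pow_mul_unit_of_C_pow_eq_mul`). [cite: YanZhu2024MainConjNonCM, Thm. 5.7 (1) (arXiv:2412.20078v4 l.1217–1227)]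
[cite: Washington1997, §7.1] -/
theorem exists_eq_C_pow_mul_unit_mul {F' L : UnrSeries p} {k k' n : ℕ}
    (h0 : C ((p : unrIntegers p) ^ k) * L ∈ Ideal.span ({F'} : Set (UnrSeries p)))
    (h1 : C ((p : unrIntegers p) ^ k') * F' ∈ Ideal.span ({L} : Set (UnrSeries p)))
    (hL : ‖((coeff n L : unrIntegers p) : ℂ_[p])‖ = 1 ∧
      ∀ i < n, ‖((coeff i L : unrIntegers p) : ℂ_[p])‖ < 1) :
    ∃ (m : ℕ) (U : (UnrSeries p)ˣ), F' = C ((p : unrIntegers p) ^ m) * U * L := by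
  obtain ⟨a, ha⟩ := Ideal.mem_span_singleton'.mp h0
  obtain ⟨b, hb⟩ := Ideal.mem_span_singleton'.mp h1
  have hL0 : L ≠ 0 := ne_zero_of_firstUnitCoeffAt hL
  -- `F' = L · G'`
  obtain ⟨G', hG'⟩ := exists_mul_eq_of_mul_eq_C_pow_mul (F := L) (G := b) (L := F') hL
    (by rw [mul_comm, hb])
  -- `C(p^k) = a · G'`
  have hk : C ((p : unrIntegers p) ^ k) = a * G' := by
    apply mul_left_cancel₀ hL0
    calc L * C ((p : unrIntegers p) ^ k) = C ((p : unrIntegers p) ^ k) * L := mul_comm _ _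
      _ = a * F' := ha.symm
      _ = a * (L * G') := by rw [hG']
      _ = L * (a * G') := by ring
  obtain ⟨m, U, hU⟩ := exists_eq_C_pow_mul_unit_of_C_pow_eq_mul k hk
  exact ⟨m, U, by rw [← hG', hU]; ring⟩

/-- Units of `R₀` read in `ℂ_p` are non-zero. [folklore] -/
theorem coe_units_ne_zero (Ω : (unrIntegers p)ˣ) : ((Ω : unrIntegers p) : ℂ_[p]) ≠ 0 := by
  rw [← norm_pos_iff, norm_coe_units_unrIntegers]; exact one_pos

end Algebra

/-! ### §2 `(log_{ω_E} τ_* P_K)² = (log_{ω_E} P_K)²`, RANK-FREE (Darmon 2004 Prop. 3.11, discharged) -/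

section LogSymmetry

variable {p : ℕ} [Fact p.Prime] {K : Type} [Field K] [NumberField K]

/-- **Complex conjugation does not change `(log_{ω_E} P_K)²`** — NO rank hypothesis: for `W/ℚ` globally
minimal, `K` imaginary quadratic with the Heegner hypothesis for `N_E`, a Heegner point `P ∈ E(K)` of
level `N_E` (`IsHeegnerPoint`) and ANY `ℚ`-algebra automorphism `τ` of `K`, along any `ι : K → ℚ_p`:
`(log_{ω_E} τ_* P)² = (log_{ω_E} P)²`. For `τ ≠ 1`, Darmon 2004 Prop. 3.11 (tree THEOREM
`heegnerPoint_conj_add_rootNumber_smul_holds`) gives `τ_* P + w(E)·P` torsion, the logarithm is additive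
and kills torsion (`X11b.R1.logOmega_eq_padicLog`, `Additive.LocalLog.padicLog_eq_zero_iff`), and
`w(E)² = 1`. [cite: Darmon2004, Prop. 3.11 and §3.9] [cite: SilvermanAEC2009, IV.6.4 and VII.6.3] -/
theorem sq_padicLogOmega_map_eq_of_isHeegnerPoint (W : WeierstrassCurve ℚ) [W.IsElliptic]
    [W.IsGloballyMinimal] [NeZero (W.conductorNorm ℤ)] (hK : IsImaginaryQuadratic K)
    (hHN : SatisfiesHeegnerHypothesis (W.conductorNorm ℤ) K) (ι : K →+* ℚ_[p])
    {P : (W.baseChange K).toAffine.Point} (hP : IsHeegnerPoint (W.conductorNorm ℤ) W K P)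
    (τ : K →ₐ[ℚ] K) :
    padicLogOmega W p ι (WeierstrassCurve.Affine.Point.map (W' := W) τ P) ^ 2 =
      padicLogOmega W p ι P ^ 2 := by
  by_cases hτ : τ = AlgHom.id ℚ K
  · subst hτ
    have hmap : WeierstrassCurve.Affine.Point.map (W' := W) (AlgHom.id ℚ K) P = P := by
      rcases P with _ | ⟨x, y, hxy⟩ <;> rfl
    rw [hmap]
  · -- Darmon Prop. 3.11: `τ_* P + w(E) • P` is torsion
    have htors := heegnerPoint_conj_add_rootNumber_smul_holds W K hK hHN hP τ hτ
    set g : (W.baseChange K).toAffine.Point →+ (W.baseChange ℚ_[p]).toAffine.Point :=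
      WeierstrassCurve.Affine.Point.map ι.toRatAlgHom with hg
    have hread : ∀ Q : (W.baseChange K).toAffine.Point,
        padicLogOmega W p ι Q = Additive.LocalLog.padicLog (W.baseChange ℚ_[p]) (g Q) :=
      fun Q ↦ X11b.R1.logOmega_eq_padicLog W p ι Q
    have hzero : Additive.LocalLog.padicLog (W.baseChange ℚ_[p])
        (g (WeierstrassCurve.Affine.Point.map (W' := W) τ P + W.rootNumber • P)) = 0 :=
      (Additive.LocalLog.padicLog_eq_zero_iff _ _).mpr (g.isOfFinAddOrder htors)
    rw [map_add, map_zsmul, map_add, map_zsmul, ← hread, ← hread, zsmul_eq_mul] at hzero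
    have hneg : padicLogOmega W p ι (WeierstrassCurve.Affine.Point.map (W' := W) τ P) =
        -((W.rootNumber : ℚ_[p]) * padicLogOmega W p ι P) := eq_neg_of_add_eq_zero_left hzero
    rw [hneg]
    rcases W.rootNumber_eq_one_or with hw | hw <;> rw [hw] <;> push_cast <;> ring

/-- **The Galois re-reading of a Heegner datum** (imaginary quadratic `K`): for a complex embedding
`ι_K` and an infinite place `w₀` there is a `ℚ`-automorphism `τ` of `K` such that `τ_* P` reads through
`w₀.embedding` whatever `P` reads through `ι_K`. (Adapted from `X1.KellerYinHalves.exists_involution_map_eq`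
/ `X11b.R1.exists_involution_map_eq`, with `τ` kept as an algebra automorphism.) [folklore] -/
theorem exists_algHom_map_map_eq (hK : IsImaginaryQuadratic K) (ιK : K →+* ℂ) (w₀ : InfinitePlace K)
    {W : WeierstrassCurve ℚ} {N : ℕ} [NeZero N] (Dt : ModularParametrizationData W N)
    (H : HeegnerDatum N (NumberField.discr K)) {P : (W.baseChange K).toAffine.Point}
    (hP : WeierstrassCurve.Affine.Point.map ιK.toRatAlgHom P = heegnerPointComplex Dt H) :
    ∃ τ : K →ₐ[ℚ] K,
      WeierstrassCurve.Affine.Point.map w₀.embedding.toRatAlgHom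
          (WeierstrassCurve.Affine.Point.map (W' := W) τ P) = heegnerPointComplex Dt H := by
  haveI : IsGalois ℚ K := by
    haveI : Algebra.IsQuadraticExtension ℚ K := ⟨hK.1⟩
    infer_instance
  obtain ⟨σ, hσ⟩ := ComplexEmbedding.exists_comp_symm_eq_of_comp_eq (k := ℚ) w₀.embedding ιK
    (by ext x; simp)
  refine ⟨(σ.symm : K ≃ₐ[ℚ] K), ?_⟩
  rw [WeierstrassCurve.Affine.Point.map_map]
  have hcomp : w₀.embedding.toRatAlgHom.comp ((σ.symm : K ≃ₐ[ℚ] K) : K →ₐ[ℚ] K) = ιK.toRatAlgHom := by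
    apply AlgHom.ext
    intro x
    have := RingHom.congr_fun hσ x
    simpa using this
  rw [hcomp]
  exact hP

end LogSymmetry

end Summit.BirchSwinnertonDyer.Rank1Residual.X11b.YZComposite

end
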